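import Mathlib

/-! # Route CapacityClassicality — θ-shadow inequality (stub for crux stmt-Langlands-8927, line Sketch)

An exact `U_p`-eigen sequence `b (p * n) = λ * b n` satisfies `b (p ^ j * n) = λ ^ j * b n`, so if the
eigenvalue `λ`, viewed `p`-adically through a ring isomorphism `ι : PadicAlgCl p ≃+* ℂ`, has norm
`‖ι⁻¹ λ‖ ≤ p ^ (1 - k)` (slope `≥ k - 1`, as Coleman's classicality criterion forces for a
non-classical overconvergent eigenform of weight `k`), then the coefficients decay along every
`p`-power tower: `‖ι⁻¹ (b (p ^ j * n))‖ ≤ (p ^ (1 - k)) ^ j * ‖ι⁻¹ (b n)‖`.  This is the `q`-expansion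
shadow of the presentation `g = θ^(k-1) h`.  Pure algebra: induction on `j`, multiplicativity of the
(`p`-adic, spectral) norm on `PadicAlgCl p`, and monotonicity of `x ↦ x ^ j` on `[0, ∞)`.
-/

set_option linter.dupNamespace false -- `Summit.Langlands.Langlands` is the mandated namespace

namespace Summit.Langlands.Langlands.Theorems.CapacityClassicality

/-- **Iterated `U_p`-eigen relation.** If `b (p * n) = lam * b n` for all `n`, then
`b (p ^ j * n) = lam ^ j * b n` for all `j, n`.  Induction on `j`. [folklore] -/
theorem apply_prime_pow_mul_eq_pow_mul (p : ℕ) (b : ℕ → ℂ) (lam : ℂ)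
    (hU : ∀ n, b (p * n) = lam * b n) (j n : ℕ) : b (p ^ j * n) = lam ^ j * b n := by
  induction j with
  | zero => simp
  | succ j ih => rw [pow_succ' p j, mul_assoc, hU, ih, pow_succ' lam j, mul_assoc]

/-- **θ-shadow inequality along a `U_p`-tower.** Let `ι : PadicAlgCl p ≃+* ℂ` be a ring
isomorphism, `b : ℕ → ℂ` an exact `U_p`-eigen sequence, `b (p * n) = lam * b n`, whose eigenvalue
satisfies `‖ι⁻¹ lam‖ ≤ p ^ (1 - k)`.  Then for all `j, n`,
`‖ι⁻¹ (b (p ^ j * n))‖ ≤ (p ^ (1 - k)) ^ j * ‖ι⁻¹ (b n)‖`.  Proof: `b (p ^ j * n) = lam ^ j * b n`,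
transport through the ring isomorphism `ι⁻¹`, use multiplicativity of the norm on the normed field
`PadicAlgCl p` (`norm_mul`, `norm_pow`) and `pow_le_pow_left₀`. [folklore] -/
theorem theta_shadow (p : ℕ) [Fact p.Prime] (k : ℕ) (ι : PadicAlgCl p ≃+* ℂ) (b : ℕ → ℂ)
    (lam : ℂ) (hU : ∀ n, b (p * n) = lam * b n)
    (hslope : ‖ι.symm lam‖ ≤ (p : ℝ) ^ (-(k : ℤ) + 1)) :
    ∀ j n : ℕ, ‖ι.symm (b (p ^ j * n))‖ ≤ ((p : ℝ) ^ (-(k : ℤ) + 1)) ^ j * ‖ι.symm (b n)‖ := by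
  intro j n
  rw [apply_prime_pow_mul_eq_pow_mul p b lam hU j n, map_mul, map_pow, norm_mul, norm_pow]
  exact mul_le_mul_of_nonneg_right (pow_le_pow_left₀ (norm_nonneg _) hslope j) (norm_nonneg _)

/-- **θ-shadow inequality**, under the name registered for the stub of line `Sketch`
(crux `stmt-Langlands-8927`): verbatim restatement of `theta_shadow`. [folklore] -/
theorem stub_theta_shadow (p : ℕ) [Fact p.Prime] (k : ℕ) (ι : PadicAlgCl p ≃+* ℂ) (b : ℕ → ℂ)
    (lam : ℂ) (hU : ∀ n, b (p * n) = lam * b n)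
    (hslope : ‖ι.symm lam‖ ≤ (p : ℝ) ^ (-(k : ℤ) + 1)) :
    ∀ j n : ℕ, ‖ι.symm (b (p ^ j * n))‖ ≤ ((p : ℝ) ^ (-(k : ℤ) + 1)) ^ j * ‖ι.symm (b n)‖ :=
  theta_shadow p k ι b lam hU hslope

end Summit.Langlands.Langlands.Theorems.CapacityClassicality
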